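import Mathlib

/-!
# Kernel ridge conditioning — DEQ-A39, Lemma A39-1(a) (receipt; fully proved)

HONEST FRAMING: instance-level adjudication of specific advantage claims; no claim about
BQP vs BPP or the summit.

Source: Goel–Myers–Shrapnel, *Quantum algorithms for causal estimands*, arXiv:2505.12873v2,
Quantum Sci. Technol. 11 (2026) 015024, Algorithm 1: the quantum linear-system step inverts
`A = K_AA ⊙ K_XX + nλI`, whose condition number the paper gives as
`κ = (e_max + nλ)/(e_min + nλ)` (Sec. "Condition Number Considerations").
DEQ-A39 (pub-qadeq-deq-1/DEQ-A39.md) Lemma A39-1(a): for bounded normalised kernels the Gram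
matrix `K` has entries of absolute value at most `1` and is positive semidefinite, so every
Rayleigh quotient of `K + c•1` lies in `[c, n + c]`; with `c = nλ` the ratio is `1 + 1/λ`,
independent of the sample size `n`.  This file proves exactly these quadratic-form bounds
for a real matrix indexed by a `Fintype`, plus the one-line arithmetic of the ratio.

Intended tree location (to be filed by a permitted role, not by a planner seat):
`lean/Summits/QuantumAdvantage/Dequantization/KernelRidgeConditioning.lean`.
-/

namespace Summit.QuantumAdvantage.Dequantization.KernelRidgeConditioning

open Matrix Finset

variable {m : Type*} [Fintype m]

/-- Upper Rayleigh bound: if every entry of the real matrix `K` has absolute value `≤ 1`,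
then `vᵀ K v ≤ (card m) · vᵀ v` for every vector `v` (DEQ-A39 Lemma A39-1(a), upper half;
proof: `Σ K_ij v_i v_j ≤ (Σ |v_i|)² ≤ card · Σ v_i²`). -/
theorem dotProduct_mulVec_le_card_mul (K : Matrix m m ℝ) (hK : ∀ i j, |K i j| ≤ 1)
    (v : m → ℝ) : v ⬝ᵥ (K *ᵥ v) ≤ (Fintype.card m : ℝ) * (v ⬝ᵥ v) := by
  classical
  have h1 : v ⬝ᵥ (K *ᵥ v) = ∑ i, ∑ j, K i j * v i * v j := by
    simp only [dotProduct, Matrix.mulVec, Finset.mul_sum]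
    refine Finset.sum_congr rfl fun i _ => Finset.sum_congr rfl fun j _ => by ring
  have h2 : ∑ i, ∑ j, K i j * v i * v j ≤ ∑ i, ∑ j, |v i| * |v j| := by
    refine Finset.sum_le_sum fun i _ => Finset.sum_le_sum fun j _ => ?_
    calc K i j * v i * v j ≤ |K i j * v i * v j| := le_abs_self _
      _ = |K i j| * (|v i| * |v j|) := by rw [abs_mul, abs_mul, mul_assoc]
      _ ≤ 1 * (|v i| * |v j|) := mul_le_mul_of_nonneg_right (hK i j) (by positivity)
      _ = |v i| * |v j| := one_mul _
  have h3 : ∑ i, ∑ j, |v i| * |v j| = (∑ i, |v i|) ^ 2 := by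
    rw [sq, Finset.sum_mul_sum]
  have h4 : (∑ i, |v i|) ^ 2 ≤ (Fintype.card m : ℝ) * ∑ i, |v i| ^ 2 := by
    have h := sq_sum_le_card_mul_sum_sq (s := (Finset.univ : Finset m)) (f := fun i => |v i|)
    simpa using h
  have h5 : ∑ i, |v i| ^ 2 = v ⬝ᵥ v := by
    simp [dotProduct, sq]
  calc v ⬝ᵥ (K *ᵥ v) = ∑ i, ∑ j, K i j * v i * v j := h1
    _ ≤ ∑ i, ∑ j, |v i| * |v j| := h2
    _ = (∑ i, |v i|) ^ 2 := h3
    _ ≤ (Fintype.card m : ℝ) * ∑ i, |v i| ^ 2 := h4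
    _ = (Fintype.card m : ℝ) * (v ⬝ᵥ v) := by rw [h5]

/-- The quadratic form of the regularised matrix splits: `vᵀ (K + c•1) v = vᵀ K v + c · vᵀ v`. -/
theorem dotProduct_regularised_mulVec [DecidableEq m] (K : Matrix m m ℝ) (c : ℝ) (v : m → ℝ) :
    v ⬝ᵥ ((K + c • (1 : Matrix m m ℝ)) *ᵥ v) = v ⬝ᵥ (K *ᵥ v) + c * (v ⬝ᵥ v) := by
  rw [Matrix.add_mulVec, Matrix.smul_mulVec, Matrix.one_mulVec, dotProduct_add,
    dotProduct_smul, smul_eq_mul]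

/-- DEQ-A39 Lemma A39-1(a): two-sided Rayleigh bounds for the regularised kernel matrix.
If `K` has entries of absolute value `≤ 1`, its quadratic form is nonnegative
(positive semidefiniteness, stated as `∀ x, 0 ≤ xᵀ K x`), and `c ≥ 0`, then for every `v`
`c · vᵀv ≤ vᵀ (K + c•1) v ≤ (card m + c) · vᵀv`.  With `card m = n` and `c = nλ` these are the
bounds `nλ ≤ Rayleigh ≤ n + nλ`, whence `κ(K + nλI) ≤ 1 + 1/λ` (see `conditionRatio_eq`). -/
theorem regularised_quadForm_bounds [DecidableEq m] (K : Matrix m m ℝ)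
    (hK : ∀ i j, |K i j| ≤ 1) (hpsd : ∀ x : m → ℝ, 0 ≤ x ⬝ᵥ (K *ᵥ x)) (c : ℝ) (hc : 0 ≤ c)
    (v : m → ℝ) :
    c * (v ⬝ᵥ v) ≤ v ⬝ᵥ ((K + c • (1 : Matrix m m ℝ)) *ᵥ v) ∧
      v ⬝ᵥ ((K + c • (1 : Matrix m m ℝ)) *ᵥ v) ≤ ((Fintype.card m : ℝ) + c) * (v ⬝ᵥ v) := by
  have _ := hc
  rw [dotProduct_regularised_mulVec]
  constructor
  · have h0 := hpsd v
    linarith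
  · have hup := dotProduct_mulVec_le_card_mul K hK v
    linarith

/-- The same bounds with Mathlib's `Matrix.PosSemidef` as the positivity hypothesis
(for real matrices `star x = x`). -/
theorem regularised_quadForm_bounds_of_posSemidef [DecidableEq m] (K : Matrix m m ℝ)
    (hK : ∀ i j, |K i j| ≤ 1) (hpsd : K.PosSemidef) (c : ℝ) (hc : 0 ≤ c) (v : m → ℝ) :
    c * (v ⬝ᵥ v) ≤ v ⬝ᵥ ((K + c • (1 : Matrix m m ℝ)) *ᵥ v) ∧
      v ⬝ᵥ ((K + c • (1 : Matrix m m ℝ)) *ᵥ v) ≤ ((Fintype.card m : ℝ) + c) * (v ⬝ᵥ v) := by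
  refine regularised_quadForm_bounds K hK (fun x => ?_) c hc v
  have h := hpsd.dotProduct_mulVec_nonneg x
  simpa using h

/-- Entries of a Gram matrix of vectors of norm `≤ 1` have absolute value `≤ 1`
(Cauchy–Schwarz); this is how hypothesis `hK` arises for `K_ij = ⟨φ_i, φ_j⟩` with bounded
normalised feature vectors (DEQ-A39, standing assumption (H)). -/
theorem abs_inner_le_one_of_norm_le_one {E : Type*} [NormedAddCommGroup E]
    [InnerProductSpace ℝ E] (x y : E) (hx : ‖x‖ ≤ 1) (hy : ‖y‖ ≤ 1) :
    |@inner ℝ E _ x y| ≤ 1 := by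
  calc |@inner ℝ E _ x y| ≤ ‖x‖ * ‖y‖ := abs_real_inner_le_norm x y
    _ ≤ 1 * 1 := mul_le_mul hx hy (norm_nonneg _) zero_le_one
    _ = 1 := one_mul 1

/-- The arithmetic of the condition-number bound: `(n + nλ)/(nλ) = 1 + 1/λ` for `n, λ > 0`
— the sample size cancels (DEQ-A39 Lemma A39-1(a), last clause). -/
theorem conditionRatio_eq (n lam : ℝ) (hn : 0 < n) (hlam : 0 < lam) :
    (n + n * lam) / (n * lam) = 1 + 1 / lam := by
  field_simp
  ring

/-- Monotone form used with the paper's own formula `κ = (e_max + nλ)/(e_min + nλ)`: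
if `0 ≤ e_min` and `e_max ≤ n` then `κ ≤ (n + nλ)/(nλ)` (`= 1 + 1/λ` by `conditionRatio_eq`). -/
theorem conditionNumber_le (n lam emin emax : ℝ) (hn : 0 < n) (hlam : 0 < lam)
    (hmin : 0 ≤ emin) (hmax : emax ≤ n) :
    (emax + n * lam) / (emin + n * lam) ≤ (n + n * lam) / (n * lam) := by
  have hnl : 0 < n * lam := mul_pos hn hlam
  have hden : 0 < emin + n * lam := by linarith
  rw [div_le_div_iff₀ hden hnl]
  have h1 : (emax + n * lam) * (n * lam) ≤ (n + n * lam) * (n * lam) :=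
    mul_le_mul_of_nonneg_right (by linarith) hnl.le
  have h2 : (n + n * lam) * (n * lam) ≤ (n + n * lam) * (emin + n * lam) :=
    mul_le_mul_of_nonneg_left (by linarith) (by positivity)
  exact h1.trans h2

end Summit.QuantumAdvantage.Dequantization.KernelRidgeConditioning
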